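import Summits.BirchSwinnertonDyer.BirchSwinnertonDyer.Theorems.ErratumRoadFiveNonSurjCornerHybridSupplyKeyed
import Summits.BirchSwinnertonDyer.BirchSwinnertonDyer.Theorems.ErratumRoadFiveNonSurjCornerEulerHalfCornerPAnchorOfLabelsE0Prime
import HarnessLib

/-!
# Route `ErratumRoadFive` (rung K2), crux `NonSurjCorner` (item stmt-BirchSwinnertonDyer-19065), line `Lines/hybrid.lean`:
# GLUE #23 — the composition of the r21 skeleton candidate: FIVE stubs {deep witness, twin-lower supplies, fifteen facts, 2 + 4 names, LAB′} —
# slot 6′ = the labelled CM family with GROSS'S E′-LABEL at the carriers (the identity-component label (B6) is no longer asked)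
# (cell `bsd-stepL`, seat `bsd-stepL-corner-p1` g18; `--supports stmt-BirchSwinnertonDyer-19065 --as helper`)

WHY THIS FILE. `…EulerHalfCornerPAnchorOfLabelsE0Prime` (this seat g18) re-keys the corner's Euler-half pieces on LAB′ (E′ instead of (B6); lane -w3 g5's
E′-keyed saved order bound). This is the line glue over it: glue #22 (`…HybridSupplyKeyed`) with `hLabB6T` ↦ `hLabE0T`. Slot 6 of r17–r20 implies slot 6′
(`NonSurjCorner.carrierLabelsE0Prime_of_carrierLabelsB6`), so r20's texts imply r21's and registering r21 loses nothing. NEXT (r22, once -w6 g0's road-B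
port `…CarrierLocalE0OddPrime` p648969 is served): LAB′ ⟸ `shimuraCurve_heegnerSystem_primitivesFromFiveIrr` (print) + the carrier-local E′ analysis + the
relative stabilizer law + ONE Chebotarev–Kummer auxiliary-prime supply AT THE CORNER IMAGE — the only place `Surj` entered road B on crux 19715
(`AuxPrimeSupply.auxiliaryPrimeSupply`); item 27982 then leaves 19065's cone.
* §1 GLUE #23 `nonSurjCorner_of_deepWitness_of_twinLowerSupply_of_fifteenFacts_of_twoPlusFourNamedInputs_of_carrierLabelsE0Prime_pAnchor`.

HONEST FRAMING: ONE THEOREM (no definition, no named fact, no `sorry`); CONDITIONAL on every displayed binder; no stub is proved — slot 6 is asked in a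
WEAKER form; 19065 NOT closed by this file; nothing about any curve's BSD; BSD is not advanced; T7.
References (locators only): [cite: GrossLMS1991, §6 proof of Prop. 6.2 (1)] [cite: Cha2005, Thm. 21 and Rmk. 25] [cite: McCallumLMS1991, §5 Cor. 5.6]
[cite: Kato2004Asterisque, Thm. 12.4, §17.13] [cite: HoffsteinLuo1997, Theorem (§1)] [cite: PastenShimura2024, Prop. 6.13, Lemma 6.18] [cite: Miller2011LMS, Def. 1.1].
-/

set_option autoImplicit false
set_option linter.dupNamespace false -- `Summit.BirchSwinnertonDyer.BirchSwinnertonDyer` (summit = problem), tree-wide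

noncomputable section

open scoped Classical NumberField MatrixGroups ModularForm

/-! ### §1 Glue #23: the composition with slot 6 keyed on Gross's E′-label -/

namespace Summit.BirchSwinnertonDyer.BirchSwinnertonDyer.Theorems

open CongruenceSubgroup WeierstrassCurve NumberField IsDedekindDomain Field Rat.HeightOneSpectrum
  Literature.NumberTheory.EllipticCurves
  Literature.NumberTheory.EllipticCurves.ModularForms
  Literature.NumberTheory.Automorphic
  Literature.NumberTheory.EllipticCurves.Rank1Residual
  Literature.NumberTheory.EllipticCurves.Rank1Residual.Typed
  Literature.NumberTheory.EllipticCurves.Wuthrich2014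
  Literature.NumberTheory.EllipticCurves.SteinWuthrich2013
  Literature.NumberTheory.EllipticCurves.Greenberg1999
  Literature.NumberTheory.EllipticCurves.Kato2004
  Literature.NumberTheory.EllipticCurves.BarriosEtAl2025
  Literature.NumberTheory.EllipticCurves.EmertonPollackWeston2006
  Literature.NumberTheory.EllipticCurves.ShimuraCMFamily
  Literature.NumberTheory.GaloisRepresentations Literature.NumberTheory.GaloisCohomology
  Summit.BirchSwinnertonDyer.Rank1Residual
  Summit.BirchSwinnertonDyer.Rank1Residual.X11b
  Summit.BirchSwinnertonDyer.Rank1Residual.X11b.Three.Koly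
  Summit.BirchSwinnertonDyer.BirchSwinnertonDyer.Theses.ErratumRoadFive

/-- **GLUE #23 — glue #22 with slot 6 re-keyed on LAB′ (Gross's E′-label at the carriers instead of (B6)).** Binders: `hWit` (slot 1′) → `hSup2`
(slot 2″) → `hF3` (fifteen facts) → hMax2 → hShim4 → `hLabE0T` (slot 6′ = LAB′) → `NonSurjCorner`. Proof = glue #22 with the multi-carrier road taken from
`…EulerHalfCornerPAnchorOfLabelsE0Prime` §4. CONDITIONAL on every binder; 19065 NOT closed; nothing booked; T7.
[cite: GrossLMS1991, §6 proof of Prop. 6.2 (1) (p. 245)] [cite: Kato2004Asterisque, Thm. 12.4, §17.13] [cite: Cha2005, Thm. 21 and Rmk. 25]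
[cite: McCallumLMS1991, §5 Cor. 5.6] [cite: HoffsteinLuo1997, Theorem (§1)] [cite: PastenShimura2024, Lemma 6.18] [cite: Miller2011LMS, Def. 1.1] -/
theorem nonSurjCorner_of_deepWitness_of_twinLowerSupply_of_fifteenFacts_of_twoPlusFourNamedInputs_of_carrierLabelsE0Prime_pAnchor
    -- slot 1′ (r19): ONE DEEP WITNESS per deep corner pair (slots 1 + 2b of r18 merged, ∃-recut)
    (hWit : ∀ (W : WeierstrassCurve ℚ) [W.IsElliptic] [W.IsGloballyMinimal] (p : ℕ) [Fact p.Prime],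
        ClassX11b W p → ¬ Surj W p → (p = 5 ∨ p = 7) → p ∣ padicValInt p W.minimalDiscriminantInt →
        ¬ Ram W p → (∃ s : ℚ, shaAn W = (s : ℂ) ∧ 0 < padicValRat p s) →
        ∃ (N : ℕ) (_ : NeZero N) (K : Type) (_ : Field K) (_ : NumberField K)
          (Dt : ModularParametrizationData W N) (H : HeegnerDatum N (NumberField.discr K)) (ι : K →+* ℂ)
          (P : (W.baseChange K).toAffine.Point),
          W.conductorNorm ℤ = N ∧ IsImaginaryQuadratic K ∧ 4 < (NumberField.discr K).natAbs ∧
          SatisfiesHeegnerHypothesis N K ∧ (W.quadraticTwist (NumberField.discr K : ℚ)).entireLFunction 1 ≠ 0 ∧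
          WeierstrassCurve.Affine.Point.map ι.toRatAlgHom P = heegnerPointComplex Dt H ∧ ¬ (p : ℤ) ∣ Dt.c ∧
          ((∃ (d₁ : KolyvaginHeegnerData Dt H.β ι 1) (y : (W.baseChange K).toAffine.Point),
              WeierstrassCurve.Affine.Point.map (W' := W) (algebraMap K (ringClassField K ι 1)).toRatAlgHom y =
                d₁.derivedPoint ∧
              ∃ Q : (W.baseChange K).toAffine.Point, ((p ^ (padicValNat p W.tamagawaProduct + 1) : ℕ) : ℤ) • Q = y) →
            ∃ M : ℕ, M ≤ padicValNat p W.tamagawaProduct ∧ CertificateAt Dt H.β ι p M) ∧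
          (∀ (Wd : WeierstrassCurve ℚ) [Wd.IsElliptic] [Wd.IsGloballyMinimal] (Cd : VariableChange ℚ),
            Cd • W.quadraticTwist (NumberField.discr K : ℚ) = Wd →
            ClassX11a Wd p → ¬ Surj Wd p → p ∣ padicValInt p Wd.minimalDiscriminantInt →
            ∀ {N : ℕ} [NeZero N] (f : CuspForm (Gamma0 N) 2), IsNewformOf Wd f →
            ∀ (ϖ : ℚ), (ϖ : ℝ) * Wd.realPeriodRat = plusPeriod f →
            ∀ (a : ℚ_[p]) (L : PowerSeries ℚ_[p]),
              (Wd.HasSplitMultiplicativeReductionAtPrime p → a = 1) →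
              (¬ Wd.HasSplitMultiplicativeReductionAtPrime p → a = -1) →
              IsMultPAdicLFunctionOf f p a L →
              ∃ n : ℕ, ‖PowerSeries.coeff n (PowerSeries.C ((ϖ : ℚ) : ℚ_[p]) * L)‖ = 1))
    -- slot 2″ (r20): the twin-lower SUPPLIES of every corner pair (∃-shape): inert frames (`FHTwinLowerSupplyAt`) ∧ the MAX frame
    (hSup2 : ∀ (W : WeierstrassCurve ℚ) [W.IsElliptic] [W.IsGloballyMinimal] (p : ℕ) [Fact p.Prime],
        ClassX11b W p → ¬ Surj W p → (p = 5 ∨ p = 7) → p ∣ padicValInt p W.minimalDiscriminantInt → ¬ Ram W p →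
        FHTwinLowerSupplyAt W p ∧
        (∃ (K : Type) (_ : Field K) (_ : NumberField K), IsImaginaryQuadratic K ∧ 4 < (NumberField.discr K).natAbs ∧
          SatisfiesHeegnerHypothesis (W.conductorNorm ℤ) K ∧ SatisfiesHeegnerHypothesis 2 K ∧
          (W.quadraticTwist (NumberField.discr K : ℚ)).entireLFunction 1 ≠ 0 ∧
          ∀ (Wd : WeierstrassCurve ℚ) [Wd.IsElliptic] [Wd.IsGloballyMinimal] (Cd : VariableChange ℚ),
            Cd • W.quadraticTwist (NumberField.discr K : ℚ) = Wd → ¬ Surj Wd p → Typed.MissingLowerBoundAt Wd p))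
    -- slot 3 (r14): FIFTEEN named facts — r11–r13's sixteen minus conjunct 16 (Cha 2005 Rmk. 25 upper, discharged inside on the corner)
    (hF3 :
      (∀ (N : ℕ) [NeZero N] (W : WeierstrassCurve ℚ) (K : Type) [Field K] [NumberField K], Literature.NumberTheory.EllipticCurves.gross_zagier N W K) ∧
      (∀ (N : ℕ) [NeZero N] (W : WeierstrassCurve ℚ) (K : Type) [Field K] [NumberField K], Literature.NumberTheory.EllipticCurves.kolyvagin N W K) ∧
      Literature.NumberTheory.EllipticCurves.Wuthrich2014.sha_dvd_analyticSha ∧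
      Literature.NumberTheory.EllipticCurves.rank_eq_analyticRank_of_analyticRank_le_one ∧
      Literature.NumberTheory.EllipticCurves.ModularForms.exists_isNewformOf ∧
      Literature.NumberTheory.EllipticCurves.friedbergHoffstein_exists_heegnerField_split_twist_ne_zero ∧
      Literature.NumberTheory.EllipticCurves.ModularForms.mazur_not_dvd_maninConstant_of_odd ∧
      Literature.NumberTheory.EllipticCurves.SteinWuthrich2013.thm61_splitMultiplicative ∧
      Literature.NumberTheory.EllipticCurves.SteinWuthrich2013.thm61_nonsplitMultiplicative ∧
      (∀ (W : WeierstrassCurve ℚ) [W.IsElliptic] [W.IsGloballyMinimal] (p : ℕ) [Fact p.Prime], Literature.NumberTheory.EllipticCurves.greenberg_stevens (W := W) (p := p)) ∧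
      Literature.NumberTheory.EllipticCurves.Cha2005.rmk25_pow_dvd_card_sha_primary_of_certificate ∧
      Literature.NumberTheory.EllipticCurves.Kato2004.thm12_4 ∧
      Literature.NumberTheory.EllipticCurves.Kato2004.exists_multDivisibilityInputs_nonsplit_contra ∧
      Literature.NumberTheory.EllipticCurves.Kato2004.exists_multDivisibilityInputs_split_contra ∧
      Literature.NumberTheory.EllipticCurves.Kato2004.exists_multDivisibilityInputs_fine_contra)
    -- slot 4 (r7): the six Hida-side NAMED facts of x11a's non-surjective chain
    -- slot 5, conjunct 1 (r16): TWO names — Poitou–Tate for Selmer structures is a tree theorem (selmerComplement_canonical_holds)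
    (hMax2 : GrossLMS1991.prop37_2_frobeniusCongruence ∧ Gross1991_heegnerPoint_sub_ratTorsion_mem_E0_imageFree)
    -- slot 5, conjunct 2 (r17): FOUR Shimura names — the CM primitives come from slot 6's labelled family
    (hShim4 : friedbergHoffstein_exists_twist_ne_zero_inertAt ∧ nonempty_shimuraParametrizationData ∧
      PastenShimura2024_componentOrders ∧
      (∀ (K : Type) [Field K] [NumberField K], casselsTate_levelInputs K))
    -- slot 6′ (r21): LAB′ — the labelled CM family at the corner's inert frames with `d_K < −4`, WITH GROSS'S E′-LABEL AT THE CARRIER PRIMES outside `S`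
    (hLabE0T : ∀ (W : WeierstrassCurve ℚ) [W.IsElliptic] [W.IsGloballyMinimal] (p : ℕ) [Fact p.Prime],
      ClassX11b W p → ¬ Surj W p → (p = 5 ∨ p = 7) →
      ∀ (N : ℕ) [NeZero N] (K : Type) [Field K] [NumberField K] (S : Finset ℕ) (Dt : ModularParametrizationData W N)
        (X : ShimuraCurveData (∏ q ∈ S, q) (N / ∏ q ∈ S, q)) (W' : WeierstrassCurve ℚ) [W'.IsElliptic]
        (P₀ : ShimuraParametrizationData X W'),
        W.conductorNorm ℤ = N → IsImaginaryQuadratic K → NumberField.discr K < -4 → Even S.card →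
        (∀ ℓ ∈ S, ℓ.Prime ∧ ℓ ∣ N ∧ ¬ ℓ ^ 2 ∣ N ∧
          ((Ideal.span {(ℓ : ℤ)}).primesOver (𝓞 K)).ncard = 1 ∧ ¬ (ℓ : ℤ) ∣ NumberField.discr K) →
        (∀ ℓ : ℕ, ℓ.Prime → ℓ ∣ N → ℓ ∉ S → ((Ideal.span {(ℓ : ℤ)}).primesOver (𝓞 K)).ncard = 2) →
        p ∈ S → ¬ (p : ℤ) ∣ Dt.c → P₀.IsMinimalFor W →
        ∃ (ι : K →+* ℂ) (y : (W.baseChange K).toAffine.Point) (degy : ℕ)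
          (ys : (m : ℕ) → (W.baseChange (ringClassField K ι m)).toAffine.Point) (ε : ℤ), 0 < degy ∧
          padicValNat p degy = padicValNat p P₀.deg ∧
          LDerivEK W K = 8 * (Real.pi : ℂ) ^ 2 * peterssonProduct (CongruenceSubgroup.Gamma0 N) 2 Dt.f Dt.f /
              ((((Units.torsionOrder K : ℝ) / 2) ^ 2 * √|(NumberField.discr K : ℝ)| : ℝ) : ℂ) *
            ((y.canonicalHeight : ℂ) / (degy : ℂ)) ∧
          (¬ IsOfFinAddOrder y → 0 < (AddSubgroup.zmultiples y).index) ∧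
          ShimuraWalk.LabelsAt W N K ι y ys ε ∧
          ∀ (q : ℕ) [Fact q.Prime], q ∣ N → q ∉ S → p ∣ (W.baseChange ℚ_[q]).localTamagawaNumber ℤ_[q] →
            ∃ n' : ℕ, ¬ p ∣ n' ∧ ∀ m : ℕ, Squarefree m →
              (∀ r ∈ m.primeFactors, ¬ r ∣ N ∧ (Ideal.span {(r : 𝓞 K)}).IsPrime) →
              ∀ [NumberField (ringClassField K ι m)] (w : HeightOneSpectrum (𝓞 (ringClassField K ι m))),
                ((q : ℕ) : 𝓞 (ringClassField K ι m)) ∈ w.asIdeal →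
                (placeIntModel W (ringClassField K ι m) w).HasNonsingularReduction (K := ringClassField K ι m) (n' • ys m)) :
    Summit.BirchSwinnertonDyer.BirchSwinnertonDyer.Theses.ErratumRoadFive.NonSurjCorner := by
  obtain ⟨hGZ, hKo, -, hGZK, hnf, -, hMaz, hJs, hJn, hGS, hChaL, h12, hns', hsp', hfine'⟩ := hF3
  obtain ⟨h37, hF1⟩ := hMax2
  -- Poitou–Tate duality for the tree's Selmer structures: a THEOREM (Milne I 4.10(b) for the canonical maps, cell bsd-schneider p626891)
  have hPTs : ∀ (K : Type) [Field K] [NumberField K], poitouTate_selmerStructure_duality_conj K :=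
    poitouTate_conj_forall_of_selmerComplement_canonical
      (fun K _ _ n _ ↦ SchneiderFreeAdditiveX3.PoitouTateReduction.selmerComplement_canonical_holds K n)
  obtain ⟨-, hJL, hCO, hCT⟩ := hShim4
  -- the seven former slot-3 conjuncts that are THEOREMS of the tree
  have hmod : hasEntireLFunction_rat := hasEntireLFunction_rat_of_exists_isNewformOf hnf
  have hpar : nonempty_modularParametrizationData :=
    nonempty_modularParametrizationData_of_exists_isNewformOf hnf IsNewformOf.exists_maninConstant_ne_zero_holds
  have hrec : ∀ (N : ℕ) [NeZero N] (W : WeierstrassCurve ℚ) (K : Type) [Field K] [NumberField K],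
      heegnerPointOfConductor_one_galoisConj N W K :=
    fun N _ W K _ _ ↦ heegnerPointOfConductor_one_galoisConj_holds N W K
  have hD36 : ∀ (N : ℕ) [NeZero N] (W : WeierstrassCurve ℚ) (K : Type) [Field K] [NumberField K],
      phi_heegnerTau_mem_singularModuliField N W K :=
    fun N _ W K _ _ ↦ phi_heegnerTau_mem_singularModuliField_holds N W K
  have hPT : ∀ (K : Type) [Field K] [NumberField K],
      Literature.NumberTheory.GaloisCohomology.poitouTate_sum_localTatePairing_eq_zero K :=
    poitouTate_sum_localTatePairing_eq_zero_holds
  have hBR : localTamagawaNumber_quadraticTwist_two_mem_of_goodReduction :=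
    BarriosEtAl2025.localTamagawaNumber_quadraticTwist_two_mem_of_goodReduction_holds
  exact X11b.erratumRoadFive_nonSurjCorner_of_deepWitness_of_kolyJMax_of_multiUpper_of_maxTwinLowerSupply_of_twinUpper_of_casselsTate
    hGZ hKo hGZK hmod hnf hMaz hrec hD36 hChaL hCT h37
    (fun W _ _ p _ hX hns' h57 hv hnr ↦ (hSup2 W p hX hns' h57 hv hnr).2)
    (X11b.Three.Koly.nonSurjCornerKolyJ_max_of_threeNamedFacts h37 hPTs hF1)
    (fun W _ _ p _ hX hns' h57 hv hnr htam hmulti ↦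
      NonSurjCorner.missingUpperBoundAt_of_carrierLabelsE0Prime_of_twinLower_pAnchor hGZK hmod hnf hMaz hBR hJL hCO hPT hPTs hCT hLabE0T W p hX
        hns' h57 htam hmulti (hSup2 W p hX hns' h57 hv hnr).1)
    (fun Wd _ _ p _ hXa hnsd hvd hμc ↦
      missingUpperBoundAt_of_classX11a_of_multDivisibilityAt hJs hJn hGZK hmod hpar Wd p (hGS Wd p) hXa
        (X11b.multDivisibilityAt_of_katoFacts_of_muAn_contra_of_mazur Kato2004.nonempty_iwasawaH1Data_holds h12 hnf hns' hsp' hfine'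
          hMaz Wd p hXa.2.1 hXa.2.2.1 hXa.2.2.2.1 hnsd hμc))
    hWit

end Summit.BirchSwinnertonDyer.BirchSwinnertonDyer.Theorems

end
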